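import Summits.HodgeConjecture.HodgeConjecture.Theorems.F0P3InnerFormClassificationV8   -- ★ T5 V8 chain: kit (V6-A), laws, engine, reading, head `shape_of_T5`
import Literature.NumberTheory.Rogawski1990.APacketComponentRigidity                 -- ★ p825946 (typ-T4a FILE 1): the Ch. 13 dictionary tree behind (L3′)∕D7α-global
import HarnessLib

/-!
# `F0P3APacketMembersOfT5` (typ-T4a, topic T4 = P7) — «A-PACKET MEMBERS» = the MEMBERSHIP CLAUSE of Rogawski Thm. 14.6.4 ∕ the GLOBAL HALF of #75 D7α,
# EXPORTED from the T5 engine (kit-generic, theorems only, 0 `sorry`) — Theorems rendering of the HOME Lines draft `F0/P3/Lines-draft/T4a_APacketMembersOfT5.lean` (sha16 139f9e78a9ed8585)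

Cell `hodgecm-mathlib`, F0∕P3, crux H413 (`stmt-HodgeConjecture-24833`); director g16 PLAN-THROUGHPUT-P2-P5 §4 row T4 deliverable (3); twin survey `F0/P3/T4b-TREE.md` §5 W1
(«#75 GLOBAL-half glue … a corollary of the T5 engine at ED. 4 — one Theorems glue file»).  HONEST LABEL: HC_CM is proved only modulo the printed citations («named inputs
remaining 2») until rung 0 closes; this file discharges NOTHING by itself — it is kit-generic over T5's pins + laws exactly like ★ `shape_of_T5`, and becomes a statement about the
actual `U(H)` only at ED. 4's kit family of record `𝔎₀` (K9β closer of `Lines/F0_U3LettersRung1.lean`, cut-off ≈17:15Z 2026-08-31), where its open content is the SAME nine stubs.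

WHAT IT ADDS.  Print: THEOREM 14.6.4 «Let `Π′ ∈ Π_a(G′)`. Then there exist a one-dimensional representation `ξ ∈ Π(H)` … and `Π′ = Π′(ξ)`» with «If `v ∉ S₀`, set `Π′(ξ_v) = Π(ξ_v)`»
(p. 244), i.e. every local component of a member of `Π′(ξ)` at a finite place lies in the local A-packet `Π(ξ_v) = {πⁿ(ξ_v), πˢ(ξ_v)}` (non-split `v`) ∕ `{i_G(ξ_v ⊗ μ_w∘det₀)}` (split `v`)
[§13.1 p. 199; §13.3 p. 201].  The T5 head ★ `shape_of_T5` PROVES this inside its `core` step (`∀ v, clFin (cl P) v ∈ (packFin ξ v).members`, from the coefficient reading of (14.6.3),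
★ `mult_le_one_of_formula`, and the unramified member ★ `unramMember_of_pins`) but EXPORTS only (C1♮) `m ≤ 1`, (C2♯) `MemXiFamily` + archimedean pin, (C3♯) `δ = sgn ξ` — the D6 ENVELOPE
`MemXiFamily` forgets WHICH ξ-local family carries `P`'s constituents.  The booked letter #75 D7α (`GelbartRogawski1991.xiEnvelope_nonsplit_isThetaType`, road 27455) needs, for its
GLOBAL half, exactly the forgotten clause: «the constituents of `P` at a non-split `v` are MEMBERS of the A-packet of record `packFin ξ v = ⟨πⁿ(ξ_v), some πˢ_rec(ξ_v)⟩`» (T4b-TREE W1).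
This file re-exports it, kit-generically and at the kit FAMILY, so that at ED. 4 the cotangent consumer's #75 can be RE-DENOMINATED to its LOCAL half (GR91 §5 theta dictionary
`πⁿ = Θ_{V⁺}(χ)`, `πˢ = Θ_{V⁻}(χ)` — topic T7) by ONE `exact` on `aPacketMembersGuarded_of_T5 𝔎₀ hpin₀ hlaws₀`.

THE CUT in s554 terms (statement + stubs + kernel-checked composition):
* COMPOSITION (this file, PROVED): `aPacketMembers_of_T5` (one frame, one kit) and `aPacketMembersGuarded_of_T5` (kit family, letters' frames).
* STUBS it rides on = T5's, BY NAME, no new ones: at `𝔎₀` the ED. 4 set of record {`stub_rung0`, `stub_T1b`, `stub_TF`, `stub_L2SA`, `stub_L3`, `stub_XLPU`, `stub_79`, `stub_SSG`, `stub_Keys`}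
  (K8-LETTERS.F0P3g5 §13) ⇒ `𝔎₀.IsPinned ∧ 𝔎₀.Laws`.  Which of them THIS clause actually consumes (census of the proof below): pins (i)(ii)(ix)(x); laws `routing` (L3′ = #82 ∕ `stub_L3`),
  `localExpansion` + `aPacketSpectral` + `transferS` + `matchingS` + `factorisation` + `traceIdentity` + `spectralSideGp` + `linIndepS` + `unitaryCoord` + `unitaryPacket` + `hatBounded` +
  `unrStarAlgebra` + `evpConvention` (through ★ `coefficientFormula_of_laws_grouped` = the (14.6.2)∕(14.6.3) coefficient reading), `xiUnram` (#79), `xiFamilyFin`, `localIsotypyFin` (★ at 𝔠₀ for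
  cotangent `P`).  NOT consumed: `tokenInf`, `archPacketCoh`, `archMember`, `cptXiSpec` (the archimedean pin is not part of the membership clause).
* DOWNSTREAM STUB SLOTS for tomorrow's line (named here, typed by their topics): `stub_packFin₀_nonsplit` — at `𝔠₀`, `(packFin₀ ξ v).πn = πⁿ_Keys(ξ_v)` and `.πs = some πˢ_rec(ξ_v)` with
  the 13.1.4 identities (Q_CM #86 ★ `CMCharIdentityPackage` + NF1 `KeysCaseTwo`; P3b∕T3); `stub_GR91_theta` — `πⁿ(ξ_v) = Θ_{V⁺}(χ)`, `πˢ(ξ_v) = Θ_{V⁻}(χ)` [GelbartRogawski1991 Lem. 5.1.2,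
  Prop. 5.2.2] (T7).  With them: #75 for cotangent `Kc`-trivial `P` = `aPacketMembersGuarded_of_T5` + `stub_packFin₀_nonsplit` + `stub_GR91_theta` (M-size glue, 1 prover + 1 referee).
The QUASI-SPLIT print behind the consumed law `routing` (Thm. 13.3.6 (c), §15.3 ¶1) and behind `aPacketSpectral` (Thms. 13.3.4∕13.3.5∕13.3.7, Lemma 13.6.3 (b)) is the typ-T4a dictionary
tree ★ `APacketComponentRigidity` (`isAPacket_of_aPacketAt`, `thm1336c_shape_of`), `APacketEigenvalueGerm` (`aPacketGerm_G_sum∕H_sum`), `ResidualSpectrumU3` — LETTER-R5 (twisted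
comparison Thm. 10.3.1), not payable at floor 0 (T4a-TREE.md ∕ T4b-TREE.md §1).

DEF∕PROOF discipline: theorems only; no `def`, no instance, no notation, no `sorry`; `--supports stmt-HodgeConjecture-24833` (helper: consumed BY NAME by the ED. 4∕#75 glue, T4b-TREE W1).
-/

set_option autoImplicit false
set_option linter.dupNamespace false

attribute [local instance 100] LieRing.ofAssociativeRing

noncomputable section

open NumberField IsDedekindDomain MeasureTheory
open scoped Matrix ComplexOrder BigOperators Classical

namespace Summit.HodgeConjecture.HodgeConjecture.Cruxes.H413.F0P3APacketMembersOfT5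

open Literature.NumberTheory.Rogawski1990 Literature.NumberTheory.GaloisRepresentations
open Literature.NumberTheory.Automorphic Literature.NumberTheory.Automorphic.UnitaryGroup
open Literature.NumberTheory.Automorphic.UnitaryGroup.CotangentForms
open Literature.RepresentationTheory.BorelWallach2000
open Literature.RepresentationTheory.KonnoKonno2007
open Summit.HodgeConjecture.HodgeConjecture.Cruxes.H413.F0P3InnerFormClassificationV6 (Gp Places EvpData EqOff IsCot KcTrivial HasToken one_le_multiplicity)
open Summit.HodgeConjecture.HodgeConjecture.Cruxes.H413.F0P3InnerFormClassificationV6.ClassificationKit (Adm coordS)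
open Summit.HodgeConjecture.HodgeConjecture.Cruxes.H413.F0P3InnerFormClassificationV8

/-! ## §1 One frame, one kit: the membership clause of Thm. 14.6.4 (T5's `core` + `memb`, exported) -/

/-- **A-PACKET MEMBERS AT ONE FRAME** — for a PINNED classification kit with the laws (level guard `S₀`) and the coefficient reading, every COTANGENT-TYPE `Kc`-TRIVIAL discrete
`P` of `G′ = U(H)` carrying a degree-one token has a one-dimensional automorphic `ξ` of `H` such that: (a) `m(P) ≤ 1`; (b) at EVERY finite place `v` the coordinate class `clFin (cl P) v`
is a MEMBER of the local A-packet `packFin ξ v` («`Π′ = Π′(ξ)`», «`Π′(ξ_v) = Π(ξ_v)` for `v ∉ S₀`»: inside `S` by the coefficient reading of (14.6.3) — a class with positive multiplicity has a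
non-zero expansion coefficient, ★ `mult_le_one_of_formula`; outside `S` it is the unramified member `πⁿ(ξ_v)`, ★ `unramMember_of_pins`); (c) hence every local CONSTITUENT of `P` at `v`
(D6 currency, ★ `localPiEquiv` ∕ `inclPlace`) is a member of `packFin ξ v` (law `localIsotypyFin`, ★ at 𝔠₀ for cotangent `P`); (d) `packFin ξ` is a ξ-local family (law `xiFamilyFin`)
and (e) `MemXiFamily P … ξ` is WITNESSED BY `packFin ξ`.  Proof = the `core`∕`memb` steps of ★ `shape_of_T5`, VERBATIM up to the extra conjuncts.
[cite: Rogawski1990, §14.6 Thm. 14.6.4 p. 244; §13.1 p. 199; §13.3 p. 201; §13.7 p. 206] -/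
theorem aPacketMembers_of_T5 {L : Type} [Field L] [NumberField L] [IsCMField L] (H : Matrix (Fin 3) (Fin 3) L) (ι : L →+* ℂ) (T : GL (Fin 3) ℂ)
    (hT : (T : Matrix (Fin 3) (Fin 3) ℂ)ᴴ * H.map ι * (T : Matrix (Fin 3) (Fin 3) ℂ) = Literature.Geometry.ComplexHyperbolic.BallModel.J)
    (μ : Measure (Gp L H).automorphicQuotient) [(Gp L H).IsAutomorphicMeasure μ] (μω : HeckeCharacter L) (hμu : μω.IsUnitary)
    (𝔠 : ClassificationKit L H ι T hT μ) (hpin : 𝔠.IsPinned) {S₀ : Finset (Places L)} (hl : 𝔠.Laws μω hμu S₀) (hZ10 : 𝔠.CoefficientFormula S₀) :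
    ∀ (P : DiscreteAutomorphicRep (Gp L H) μ), IsCot L H ι T hT μ P → KcTrivial L H ι T hT μ P → ∀
      (M : Type) [AddCommGroup M] [Module ℂ M]
      (σK : Representation ℂ (uFormGroup (Fin 2) (Fin 1)).maximalCompact M) (σ𝔤 : (uFormGroup (Fin 2) (Fin 1)).lie →ₗ⁅ℝ⁆ Module.End ℂ M)
      (hM : IsGKModule (uFormGroup (Fin 2) (Fin 1)) σK σ𝔤), IsIrreducibleGK σK σ𝔤 → HasToken L H ι T hT μ P M σK σ𝔤 →
      ∀ δ : ℤ, (δ = 1 ∨ δ = -1) → upqTypeClasses σK σ𝔤 hM.ad_compat 1 δ ≠ ⊥ →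
        ∃ ξ : OneDimAutRepH L,
          𝔠.mult (𝔠.cl P) ≤ 1 ∧
          (∀ v : Places L, 𝔠.clFin (𝔠.cl P) v ∈ (𝔠.packFin ξ v).members) ∧
          (∀ (v : Places L) (c' : IrrClass ((cmDatum L 3 H).Local v)),
            (IrrClass.comap (localPiEquiv L (IsCMField.complexConj L) 3 H v) c').IsConstituentOf
                (P.finRep.smoothPart.toRepresentation.comp (inclPlace (↥(maximalRealSubfield L)) L (IsCMField.complexConj L) 3 H v)) →
              c' ∈ (𝔠.packFin ξ v).members) ∧
          ξ.IsXiLocalFamily (transpose_map_cmConjRingHom_eq_of_frame L ι H T hT) (isUnit_det_of_frame L ι H T hT) μω hμu (𝔠.packFin ξ) ∧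
          MemXiFamily P (transpose_map_cmConjRingHom_eq_of_frame L ι H T hT) (isUnit_det_of_frame L ι H T hT) μω hμu ξ := by
  intro P hP hKc M _ _ σK σ𝔤 hM hirr htok δ hδ hne'
  -- ROUTING (law (L3′) = #82 ∕ `stub_L3`; print Thm. 13.3.6 (c) + §15.3 ¶1 = ★ `thm1336c_shape_of` at dictionary level): the token routes `P` to some `ξ` off `S₁`
  obtain ⟨ξ, S₁, hξ⟩ := hl.routing P hP hKc M σK σ𝔤 hM hirr htok δ hδ hne'
  -- pin (x): the exact ramification set of `cl P` is finite (the only finiteness used)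
  have hfinR : (𝔠.ramCls (𝔠.cl P)).Finite := hpin.2.2.2.2.2.2.2.2.2 P hP hKc
  set S : Finset (Places L) := S₁ ∪ 𝔠.ram ξ ∪ hfinR.toFinset ∪ S₀ with hSdef
  have hS₀ : S₀ ⊆ S := Finset.subset_union_right
  have hS₁ : S₁ ⊆ S := (Finset.subset_union_left.trans Finset.subset_union_left).trans Finset.subset_union_left
  have hS : 𝔠.ram ξ ⊆ S := (Finset.subset_union_right.trans Finset.subset_union_left).trans Finset.subset_union_left
  have hr : Adm 𝔠 S (𝔠.cl P) :=
    ⟨fun v hv => Finset.mem_coe.2 (Finset.mem_union_left _ (Finset.mem_union_right _ (hfinR.mem_toFinset.2 hv))), hpin.2.2.2.2.2.2.2.2.1 P hKc⟩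
  have hξS : EqOff L H S (𝔠.evp (𝔠.cl P)) (𝔠.tXi ξ) := EqOff.mono L H hS₁ hξ
  -- pin (i): `mult (cl P)` IS the `L²`-multiplicity, `≥ 1` (★ `one_le_multiplicity`)
  have hm1 : (1 : ℕ∞) ≤ ((𝔠.mult (𝔠.cl P) : ℕ) : ℕ∞) := by rw [hpin.1 P]; exact one_le_multiplicity L H μ P
  have hm1' : 1 ≤ 𝔠.mult (𝔠.cl P) := by exact_mod_cast hm1
  -- THE COEFFICIENT READING of (14.6.2)∕(14.6.3) (★ `mult_le_one_of_formula`): `m ≤ 1`, and the coordinates of a class of positive multiplicity are MEMBERS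
  obtain ⟨hle, hmem⟩ := 𝔠.mult_le_one_of_formula hl.localExpansion hZ10 ξ S hS₀ hS (𝔠.cl P) hξS hr hm1'
  have hm0 : 𝔠.mult (𝔠.cl P) ≠ 0 := by omega
  obtain ⟨-, -, hfinS⟩ := hmem hm0
  -- (b) membership at EVERY finite place: inside `S` by the reading, outside `S` the unramified member (law `xiUnram` = #79 + pins (ii)(iii)(iv))
  have hfin : ∀ v : Places L, 𝔠.clFin (𝔠.cl P) v ∈ (𝔠.packFin ξ v).members := by
    intro v
    by_cases hv : v ∈ S
    · exact hfinS ⟨v, hv⟩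
    · have hv1 : v ∉ 𝔠.ram ξ := fun h => hv (hS h)
      have hv2 : v ∉ 𝔠.ramCls (𝔠.cl P) := fun h => hv (Finset.mem_coe.1 (hr.1 h))
      rw [𝔠.unramMember_of_pins hpin hl.xiUnram ξ (𝔠.cl P) v hv1 hv2 (hξS v hv)]
      exact LocalAPacket.πn_mem_members _
  -- (c) local constituents of `P` are the coordinate classes (law `localIsotypyFin`, ★ in-house at 𝔠₀ for cotangent `P`)
  have hconst : ∀ (v : Places L) (c' : IrrClass ((cmDatum L 3 H).Local v)),
      (IrrClass.comap (localPiEquiv L (IsCMField.complexConj L) 3 H v) c').IsConstituentOf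
          (P.finRep.smoothPart.toRepresentation.comp (inclPlace (↥(maximalRealSubfield L)) L (IsCMField.complexConj L) 3 H v)) →
        c' ∈ (𝔠.packFin ξ v).members := by
    intro v c' hc'
    rw [hl.localIsotypyFin P hP hKc v c' hc']
    exact hfin v
  -- (d) `packFin ξ` is a ξ-local family (law `xiFamilyFin`), (e) hence the D6 envelope, WITNESSED BY `packFin ξ`
  exact ⟨ξ, hle, hfin, hconst, hl.xiFamilyFin ξ, ⟨𝔠.packFin ξ, hl.xiFamilyFin ξ, fun v c' hc' => hconst v c' hc'⟩⟩

/-- **The same with the coefficient reading DERIVED from the laws** (★ `coefficientFormula_of_laws_grouped` ∘ ★ `perClassIdentity_of_laws` ∘ ★ `separation_of_laws` ∘ ★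
`hatInjective_of_pins` — the integrator's own mathematics, as in ★ `shapeGuarded_of_T5`). [cite: Rogawski1990, §14.6 (14.6.2)–(14.6.3) pp. 242–244; §13.7 p. 206] -/
theorem aPacketMembers_of_laws {L : Type} [Field L] [NumberField L] [IsCMField L] (H : Matrix (Fin 3) (Fin 3) L) (ι : L →+* ℂ) (T : GL (Fin 3) ℂ)
    (hT : (T : Matrix (Fin 3) (Fin 3) ℂ)ᴴ * H.map ι * (T : Matrix (Fin 3) (Fin 3) ℂ) = Literature.Geometry.ComplexHyperbolic.BallModel.J)
    (μ : Measure (Gp L H).automorphicQuotient) [(Gp L H).IsAutomorphicMeasure μ] (μω : HeckeCharacter L) (hμu : μω.IsUnitary)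
    (𝔠 : ClassificationKit L H ι T hT μ) (hpin : 𝔠.IsPinned) {S₀ : Finset (Places L)} (hl : 𝔠.Laws μω hμu S₀) :
    ∀ (P : DiscreteAutomorphicRep (Gp L H) μ), IsCot L H ι T hT μ P → KcTrivial L H ι T hT μ P → ∀
      (M : Type) [AddCommGroup M] [Module ℂ M]
      (σK : Representation ℂ (uFormGroup (Fin 2) (Fin 1)).maximalCompact M) (σ𝔤 : (uFormGroup (Fin 2) (Fin 1)).lie →ₗ⁅ℝ⁆ Module.End ℂ M)
      (hM : IsGKModule (uFormGroup (Fin 2) (Fin 1)) σK σ𝔤), IsIrreducibleGK σK σ𝔤 → HasToken L H ι T hT μ P M σK σ𝔤 →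
      ∀ δ : ℤ, (δ = 1 ∨ δ = -1) → upqTypeClasses σK σ𝔤 hM.ad_compat 1 δ ≠ ⊥ →
        ∃ ξ : OneDimAutRepH L,
          𝔠.mult (𝔠.cl P) ≤ 1 ∧
          (∀ v : Places L, 𝔠.clFin (𝔠.cl P) v ∈ (𝔠.packFin ξ v).members) ∧
          (∀ (v : Places L) (c' : IrrClass ((cmDatum L 3 H).Local v)),
            (IrrClass.comap (localPiEquiv L (IsCMField.complexConj L) 3 H v) c').IsConstituentOf
                (P.finRep.smoothPart.toRepresentation.comp (inclPlace (↥(maximalRealSubfield L)) L (IsCMField.complexConj L) 3 H v)) →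
              c' ∈ (𝔠.packFin ξ v).members) ∧
          ξ.IsXiLocalFamily (transpose_map_cmConjRingHom_eq_of_frame L ι H T hT) (isUnit_det_of_frame L ι H T hT) μω hμu (𝔠.packFin ξ) ∧
          MemXiFamily P (transpose_map_cmConjRingHom_eq_of_frame L ι H T hT) (isUnit_det_of_frame L ι H T hT) μω hμu ξ :=
  aPacketMembers_of_T5 H ι T hT μ μω hμu 𝔠 hpin hl
    (ClassificationKit.coefficientFormula_of_laws_grouped _
      (perClassIdentity_of_laws _ hl.traceIdentity hl.spectralSideGp hl.factorisation hl.matchingS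
        (separation_of_laws _ (hatInjective_of_pins _ hpin hl.evpConvention) hl.hatBounded hl.unrStarAlgebra) hl.unrStarAlgebra)
      hl.transferS hl.linIndepS hl.unitaryCoord hl.unitaryPacket hl.aPacketSpectral hl.localExpansion)

/-! ## §2 The kit FAMILY at the letters' frames (the shape the ED. 4 closer instantiates at `𝔎₀`) -/

/-- **A-PACKET MEMBERS over a NAMED PINNED KIT FAMILY WITH THE LAWS** (★ `KitFamily`, `KitFamily.IsPinned`, `KitFamily.Laws` of the V8 chain): at every letters' frame
(`L` CM, `[L⁺:ℚ] ≥ 2`, `H` of signature (2,1) at `ι` and definite elsewhere, automorphic `μ`, Rogawski's `μω` with `μω|_{𝕀_{L⁺}} = ω_{L/L⁺}`), every cotangent-type `Kc`-trivial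
discrete `P` with a degree-one token lies in `Π′(ξ)` for a one-dimensional `ξ` IN THE STRONG SENSE: its local constituents at every finite `v` are members of the family's A-packet
`packFin ξ v`, which is a ξ-local family witnessing `MemXiFamily P … ξ`.  At ED. 4's `𝔎₀` (pins ★, laws = the nine stubs) this is #75 D7α's GLOBAL half for the cotangent consumer,
modulo the identification of `packFin₀`'s non-split slot (Q_CM #86, NF1) and the GR91 §5 theta dictionary (T7). [cite: Rogawski1990, §14.6 Thm. 14.6.4 p. 244; §15.3 ¶1 p. 251; §4.8 p. 51] -/
theorem aPacketMembersGuarded_of_T5 (𝔎 : KitFamily) (hpin : KitFamily.IsPinned 𝔎) (hlaws : 𝔎.Laws) :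
    ∀ (L : Type) [Field L] [NumberField L] [IsCMField L] (ι : L →+* ℂ) (H : Matrix (Fin 3) (Fin 3) L) (T : GL (Fin 3) ℂ)
      (hT : (T : Matrix (Fin 3) (Fin 3) ℂ)ᴴ * H.map ι * (T : Matrix (Fin 3) (Fin 3) ℂ) = Literature.Geometry.ComplexHyperbolic.BallModel.J)
      (hdef : ∀ τ' : L →+* ℂ, InfinitePlace.mk τ' ≠ InfinitePlace.mk ι → (H.map τ').PosDef)
      (h2 : 2 ≤ Module.finrank ℚ ↥(maximalRealSubfield L))
      (μ : Measure (adelicGroupData (↥(maximalRealSubfield L)) L (IsCMField.complexConj L) 3 H).automorphicQuotient)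
      [(adelicGroupData (↥(maximalRealSubfield L)) L (IsCMField.complexConj L) 3 H).IsAutomorphicMeasure μ]
      (μω : HeckeCharacter L) (hμu : μω.IsUnitary)
      (hμω : ∀ x : Literature.NumberTheory.GaloisRepresentations.ideleGroup ↥(maximalRealSubfield L),
        μω (AdeleRing.ideleBaseChange (↥(maximalRealSubfield L)) L x) = quadraticHeckeCharCM L x)
      (P : DiscreteAutomorphicRep (adelicGroupData (↥(maximalRealSubfield L)) L (IsCMField.complexConj L) 3 H) μ),
      IsCot L H ι T hT μ P → KcTrivial L H ι T hT μ P → ∀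
      (M : Type) [AddCommGroup M] [Module ℂ M]
      (σK : Representation ℂ (uFormGroup (Fin 2) (Fin 1)).maximalCompact M) (σ𝔤 : (uFormGroup (Fin 2) (Fin 1)).lie →ₗ⁅ℝ⁆ Module.End ℂ M)
      (hM : IsGKModule (uFormGroup (Fin 2) (Fin 1)) σK σ𝔤), IsIrreducibleGK σK σ𝔤 → HasToken L H ι T hT μ P M σK σ𝔤 →
      ∀ δ : ℤ, (δ = 1 ∨ δ = -1) → upqTypeClasses σK σ𝔤 hM.ad_compat 1 δ ≠ ⊥ →
        ∃ ξ : OneDimAutRepH L,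
          ((adelicGroupData (↥(maximalRealSubfield L)) L (IsCMField.complexConj L) 3 H).rightRegular μ).multiplicity P.space.toContRep ≤ 1 ∧
          (∀ (v : Places L) (c' : IrrClass ((cmDatum L 3 H).Local v)),
            (IrrClass.comap (localPiEquiv L (IsCMField.complexConj L) 3 H v) c').IsConstituentOf
                (P.finRep.smoothPart.toRepresentation.comp (inclPlace (↥(maximalRealSubfield L)) L (IsCMField.complexConj L) 3 H v)) →
              c' ∈ ((𝔎 L ι H T hT hdef h2 μ μω hμu hμω).packFin ξ v).members) ∧
          ξ.IsXiLocalFamily (transpose_map_cmConjRingHom_eq_of_frame L ι H T hT) (isUnit_det_of_frame L ι H T hT) μω hμu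
            ((𝔎 L ι H T hT hdef h2 μ μω hμu hμω).packFin ξ) ∧
          MemXiFamily P (transpose_map_cmConjRingHom_eq_of_frame L ι H T hT) (isUnit_det_of_frame L ι H T hT) μω hμu ξ := by
  intro L _ _ _ ι H T hT hdef h2 μ _ μω hμu hμω P hP hKc M _ _ σK σ𝔤 hM hirr htok δ hδ hne'
  have hp := hpin L ι H T hT hdef h2 μ μω hμu hμω
  obtain ⟨S₀, hl⟩ := hlaws L ι H T hT hdef h2 μ μω hμu hμω
  obtain ⟨ξ, hle, -, hconst, hfam, hmem⟩ :=
    aPacketMembers_of_laws H ι T hT μ μω hμu (𝔎 L ι H T hT hdef h2 μ μω hμu hμω) hp hl P hP hKc M σK σ𝔤 hM hirr htok δ hδ hne'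
  refine ⟨ξ, ?_, hconst, hfam, hmem⟩
  rw [← hp.1 P]
  exact_mod_cast hle

end Summit.HodgeConjecture.HodgeConjecture.Cruxes.H413.F0P3APacketMembersOfT5

end
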